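import Mathlib.AlgebraicGeometry.ZariskisMainTheorem
import Mathlib.AlgebraicGeometry.Morphisms.FiniteType
import Mathlib.AlgebraicGeometry.Noetherian
import Mathlib.Topology.KrullDimension
import HarnessLib

/-!
# A proper morphism whose fibres over the closed points are finite is finite

Topic: `Literature/AlgebraicGeometry/Morphisms`. Pure proofs (no definition, no named fact) of the
elementary step of de Jong 1996, proof of Lemma 4.13 (p. 70): "The morphism `f|_H : H → Y` is
quasi-finite hence finite" — where quasi-finiteness of the proper `H → Y` is only checked on the
fibres over CLOSED points of `Y`; over a Jacobson base this suffices, because the points at which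
a morphism locally of finite type fails to be quasi-finite form a closed set (Zariski's Main
Theorem, Mathlib `Scheme.Hom.quasiFiniteLocus`) whose image under the closed map `f` is a closed
set and so, if non-empty, contains a closed point (Mathlib `nonempty_inter_closedPoints`).

* `topologicalKrullDim_le_zero_of_isDiscrete` — a discrete subset has Krull dimension `≤ 0`;
* `finite_preimage_singleton_of_topologicalKrullDim_le_zero` — for `f` quasi-compact and locally
  of finite type, a fibre `f⁻¹(y)` of Krull dimension `≤ 0` (in the topology induced from `X`) is
  finite (it is a Noetherian sober space all of whose points are closed in it);
* `locallyQuasiFinite_of_finite_preimage_closedPoint`,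
  `isFinite_of_isProper_of_finite_preimage_closedPoint` — **`f` proper (resp. universally closed
  and locally of finite type) over a Jacobson scheme with finite fibres over the closed points is
  finite (resp. locally quasi-finite)** (Stacks 02UP fibrewise, Mathlib
  `exists_isFinite_morphismRestrict_of_finite_preimage_singleton`, globalised over the closed
  points);
* `isFinite_of_isProper_of_topologicalKrullDim_preimage_le_zero` — the same with the hypothesis
  "`dim f⁻¹(y) ≤ 0` for `y` closed", and `topologicalKrullDim_preimage_singleton_le_zero` — the
  converse bookkeeping: every fibre of a locally quasi-finite morphism has dimension `≤ 0`.

## References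

* A. J. de Jong, *Smoothness, semi-stability and alterations*, Publ. Math. IHÉS 83 (1996) 51–93,
  proof of Lemma 4.13, p. 70. [DeJong1996]
* The Stacks Project, Tags 02UP, 01TB (points of finite type, Jacobson schemes). [StacksProject]
-/

noncomputable section

universe u

open CategoryTheory CategoryTheory.Limits AlgebraicGeometry TopologicalSpace Topology

namespace Literature.AlgebraicGeometry.Morphisms

variable {X Y : Scheme.{u}} (f : X ⟶ Y)

/-! ### Discrete subsets and Krull dimension `≤ 0` -/

/-- A discrete subset of a topological space has topological Krull dimension `≤ 0` (in the
induced topology every point is open, so there are no non-trivial specialisations). [folklore] -/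
theorem topologicalKrullDim_le_zero_of_isDiscrete {Z : Type*} [TopologicalSpace Z] {S : Set Z}
    (hS : IsDiscrete S) : topologicalKrullDim S ≤ 0 := by
  haveI : DiscreteTopology S := hS.to_subtype
  exact topologicalKrullDim_zero_of_discreteTopology S

/-- **Every fibre of a locally quasi-finite morphism has Krull dimension `≤ 0`** (its fibres are
discrete, Mathlib `Scheme.Hom.isDiscrete_preimage_singleton`). [folklore] -/
theorem topologicalKrullDim_preimage_singleton_le_zero [LocallyQuasiFinite f] (y : Y) :
    topologicalKrullDim (f ⁻¹' {y}) ≤ 0 :=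
  topologicalKrullDim_le_zero_of_isDiscrete (f.isDiscrete_preimage_singleton y)

/-- In a `T₀` space of Krull dimension `≤ 0` every point is closed: a point of `closure {x}` other
than `x` would give the chain of irreducible closed subsets `closure {z} < closure {x}`.
[folklore] -/
theorem isClosed_singleton_of_topologicalKrullDim_le_zero {Z : Type*} [TopologicalSpace Z]
    [T0Space Z] (h : topologicalKrullDim Z ≤ 0) (x : Z) : IsClosed ({x} : Set Z) := by
  rw [← closure_eq_iff_isClosed]
  refine Set.Subset.antisymm (fun z hz => ?_) subset_closure
  by_contra hzx
  have hzx' : z ≠ x := hzx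
  -- `closure {z} < closure {x}` as irreducible closed subsets
  have hlt : (⟨closure {z}, isIrreducible_singleton.closure, isClosed_closure⟩ :
      IrreducibleCloseds Z) <
      ⟨closure {x}, isIrreducible_singleton.closure, isClosed_closure⟩ := by
    refine lt_of_le_of_ne ?_ ?_
    · show closure {z} ≤ closure {x}
      exact closure_minimal (Set.singleton_subset_iff.mpr hz) isClosed_closure
    · intro heq
      have hc : closure ({z} : Set Z) = closure {x} :=
        congrArg (fun C : IrreducibleCloseds Z => (C : Set Z)) heq
      have hxz : x ⤳ z := by
        rw [specializes_iff_closure_subset, hc]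
      have hzx2 : z ⤳ x := by
        rw [specializes_iff_closure_subset, hc]
      exact hzx' (hzx2.antisymm hxz).eq
  have hmax := (Order.krullDim_nonpos_iff_forall_isMax.mp h)
    (⟨closure {z}, isIrreducible_singleton.closure, isClosed_closure⟩ : IrreducibleCloseds Z)
  exact hlt.not_isMax hmax

/-- **A fibre of Krull dimension `≤ 0` of a quasi-compact morphism locally of finite type is
finite.** The fibre `f⁻¹(y)` is homeomorphic to the scheme-theoretic fibre `X_y`, a Noetherian
sober space; if its Krull dimension is `≤ 0` all its points are closed, so each of its finitely
many irreducible components is a single point. [folklore] -/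
theorem finite_preimage_singleton_of_topologicalKrullDim_le_zero [LocallyOfFiniteType f]
    [QuasiCompact f] (y : Y) (h : topologicalKrullDim (f ⁻¹' {y}) ≤ 0) :
    (f ⁻¹' {y}).Finite := by
  -- transport to the fibre scheme `X_y`
  have hdim : topologicalKrullDim (f.fiber y) ≤ 0 := by
    rwa [IsHomeomorph.topologicalKrullDim_eq _ (f.fiberHomeo y).isHomeomorph]
  haveI : LocallyOfFiniteType (f.fiberToSpecResidueField y) :=
    MorphismProperty.pullback_snd _ _ inferInstance
  haveI : IsLocallyNoetherian (f.fiber y) :=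
    LocallyOfFiniteType.isLocallyNoetherian (f.fiberToSpecResidueField y)
  haveI : IsNoetherian (f.fiber y) := { }
  haveI : NoetherianSpace (f.fiber y) := inferInstance
  -- every point of `X_y` is closed, hence every irreducible component is a singleton
  have hpt : ∀ x : f.fiber y, IsClosed ({x} : Set (f.fiber y)) :=
    isClosed_singleton_of_topologicalKrullDim_le_zero hdim
  have hcomp : ∀ C ∈ irreducibleComponents (f.fiber y : Type u), ∃ x, C = {x} := by
    intro C hC
    obtain ⟨x, hx⟩ := (hC.1).nonempty
    refine ⟨x, Set.Subset.antisymm (fun z hz => ?_) (Set.singleton_subset_iff.mpr hx)⟩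
    -- the generic point of the irreducible closed `C` is `x` (all points closed)
    have hCcl : IsClosed C := isClosed_of_mem_irreducibleComponents C hC
    obtain ⟨ξ, hξ⟩ := QuasiSober.sober hC.1 hCcl
    have hξC : closure ({ξ} : Set (f.fiber y)) = C := hξ.def
    have hξx : ξ = x := by
      have : x ∈ closure ({ξ} : Set _) := hξC ▸ hx
      rwa [(hpt ξ).closure_eq, Set.mem_singleton_iff, eq_comm] at this
    have : z ∈ closure ({ξ} : Set _) := hξC ▸ hz
    rw [(hpt ξ).closure_eq, Set.mem_singleton_iff] at this
    rw [Set.mem_singleton_iff, this, hξx]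
  have hfin : (Set.univ : Set (f.fiber y)).Finite := by
    have hU : (Set.univ : Set (f.fiber y)) = ⋃₀ irreducibleComponents (f.fiber y : Type u) :=
      (sUnion_irreducibleComponents (X := f.fiber y)).symm
    rw [hU]
    refine Set.Finite.sUnion NoetherianSpace.finite_irreducibleComponents fun C hC => ?_
    obtain ⟨x, rfl⟩ := hcomp C hC
    exact Set.finite_singleton x
  haveI : Finite (f.fiber y) := Set.finite_univ_iff.mp hfin
  exact Set.finite_coe_iff.mp ((f.fiberHomeo y).finite_iff.mp inferInstance)

/-! ### Quasi-finiteness from the fibres over the closed points -/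

/-- **Over a Jacobson base, quasi-finiteness is decided on the fibres over the closed points**:
if `f : X → Y` is universally closed and locally of finite type, `Y` is a Jacobson space and
`f⁻¹(y)` is finite for every closed point `y`, then `f` is locally quasi-finite. The
non-quasi-finite locus is closed (Zariski's Main Theorem, Mathlib `Scheme.Hom.quasiFiniteLocus`),
so its image is closed and would contain a closed point `y`; but at every point of a finite fibre
`f` is quasi-finite (Mathlib `Scheme.Hom.quasiFiniteAt_iff_isOpen_singleton_asFiber`).
[cite: StacksProject, Tag 02UP] -/
theorem locallyQuasiFinite_of_finite_preimage_closedPoint [UniversallyClosed f]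
    [LocallyOfFiniteType f] [JacobsonSpace Y]
    (h : ∀ y : Y, IsClosed ({y} : Set Y) → (f ⁻¹' {y}).Finite) : LocallyQuasiFinite f := by
  rw [← Scheme.Hom.quasiFiniteLocus_eq_top_iff]
  by_contra hne
  -- the closed non-quasi-finite locus is non-empty
  set F : Set X := (f.quasiFiniteLocus : Set X)ᶜ with hF
  have hFcl : IsClosed F := f.quasiFiniteLocus.isOpen.isClosed_compl
  have hFne : F.Nonempty := by
    by_contra hemp
    apply hne
    ext x
    simp only [Opens.coe_top, Set.mem_univ, iff_true]
    by_contra hx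
    exact hemp ⟨x, hx⟩
  -- its closed image contains a closed point `y = f x`, `x ∈ F`
  have himg : IsClosed (f '' F) := f.isClosedMap _ hFcl
  obtain ⟨_, ⟨x, hxF, rfl⟩, hy⟩ :=
    nonempty_inter_closedPoints (hFne.image f) himg.isLocallyClosed
  -- but the fibre over `y` is finite, so `f` is quasi-finite at `x`
  apply hxF
  show f.QuasiFiniteAt x
  have : Finite (f.fiber (f x)) := (f.fiberHomeo (f x)).finite_iff.mpr (h (f x) hy)
  exact Scheme.Hom.quasiFiniteAt_iff_isOpen_singleton_asFiber.mpr (isOpen_discrete _)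

/-- **A proper morphism over a Jacobson scheme whose fibres over the closed points are finite is
finite** (de Jong 1996, proof of 4.13: "`f|_H : H → Y` is quasi-finite hence finite"; proper and
locally quasi-finite is finite, Mathlib `IsFinite.of_isProper_of_locallyQuasiFinite`).
[cite: DeJong1996, Lemma 4.13 (proof), p. 70] -/
theorem isFinite_of_isProper_of_finite_preimage_closedPoint [IsProper f] [JacobsonSpace Y]
    (h : ∀ y : Y, IsClosed ({y} : Set Y) → (f ⁻¹' {y}).Finite) : IsFinite f :=
  haveI := locallyQuasiFinite_of_finite_preimage_closedPoint f h
  .of_isProper_of_locallyQuasiFinite f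

/-- The same with the fibre hypothesis in the form "`dim f⁻¹(y) ≤ 0` for every closed point `y`"
(as in the rendering of de Jong's `H ∉ pr₁(T)`: "`dim f⁻¹(y) ∩ H ≤ 0`").
[cite: DeJong1996, Lemma 4.13 (proof), p. 70] -/
theorem isFinite_of_isProper_of_topologicalKrullDim_preimage_le_zero [IsProper f]
    [JacobsonSpace Y]
    (h : ∀ y : Y, IsClosed ({y} : Set Y) → topologicalKrullDim (f ⁻¹' {y}) ≤ 0) : IsFinite f :=
  isFinite_of_isProper_of_finite_preimage_closedPoint f fun y hy =>
    finite_preimage_singleton_of_topologicalKrullDim_le_zero f y (h y hy)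

/-- **All fibres have dimension `≤ 0` as soon as the fibres over the closed points do** (for `f`
proper over a Jacobson scheme): `f` is then finite, in particular locally quasi-finite, and the
fibres of a locally quasi-finite morphism are discrete. [cite: DeJong1996, Lemma 4.13 (proof), p. 70] -/
theorem topologicalKrullDim_preimage_singleton_le_zero_of_closedPoints [IsProper f]
    [JacobsonSpace Y]
    (h : ∀ y : Y, IsClosed ({y} : Set Y) → topologicalKrullDim (f ⁻¹' {y}) ≤ 0) (y : Y) :
    topologicalKrullDim (f ⁻¹' {y}) ≤ 0 :=
  haveI := isFinite_of_isProper_of_topologicalKrullDim_preimage_le_zero f h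
  topologicalKrullDim_preimage_singleton_le_zero f y

end Literature.AlgebraicGeometry.Morphisms

end
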